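import Summits.Ventures.DiscreteObjects.Hadamard.AutomorphismTransfer668

/-!
# No REGULAR and no GRAPHICAL Hadamard matrix of order 668 (kernel): the named sub-types that need a square order

Framing: lottery ticket; floor = certified bounds/negative ranges.  Cell pub-namedobj (venture DiscreteObjects),
target (H), hadamard gen 27.  PRINT STATUS: classical ("a regular Hadamard matrix has order `4u²`"; "for a graphical
Hadamard matrix `n` is a square", Brouwer–Haemers, *Spectra of Graphs* (2012) §10.5, via `tr S = 0`); the kernel proofs
are ours.  TABLE-H Addendum 10 listed these 'arithmetic non-rows' (regular / graphical / Bush-type / Menon-difference-set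
Hadamard matrices all require order `4u²`, and `668 = 4·167` is not of that form) at theorem-level-in-print; this file puts
the two basic ones in the kernel, for Hadamard matrices of ANY order:
* `sum_rowsum_sq` — if `Hᵀ H = n I` then `Σ_i (Σ_j H_ij)² = n · |ι|` (expand and use column orthogonality), and
  **`regular_hadamard_rowsum_sq`**: if a Hadamard matrix has all row sums equal to `s` then `s² = n`; hence
  **`no_regular_hadamard668`** (and no Bush-type / Menon-type `H(668)`, which are regular by definition).
* **`graphical_hadamard_isSquare`** — a SYMMETRIC Hadamard matrix with CONSTANT DIAGONAL has square order (spectral proof: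
  over `ℝ` the matrix is Hermitian with `H² = n I`, every eigenvalue is `±√n`, and the trace `±n = m √n` with `m ∈ ℤ`
  forces `n = m²`; Mathlib's `Matrix.IsHermitian.eigenvectorBasis` / `trace_eq_sum_eigenvalues`); hence
  **`no_graphical_hadamard668`** (no regular symmetric Hadamard matrix with constant diagonal, RSHCD, either).
* §3 (appended): **`symm_hadamard_trace_sq`** / **`symm_hadamard_trace_eq_zero`** — a symmetric Hadamard matrix of order
  `N` has `(tr H)² = m² N`, hence trace `0` when `N` is not a square; **`symmHadamard668_trace_zero`**,
  **`symmHadamard668_diag_count`**: every symmetric `H(668)` has exactly `334` diagonal entries `+1`.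
Symmetric `H(668)` (trace `0`) are not excluded — that is the open propus / Balonin–Seberry question, and `C(334) ⇒`
symmetric `H(668)` (gen 27 `ConferenceRoute668`).  WORDS: exclusion of named sub-types / structure only; `H(668)` untouched.
Ours; no `sorry`.
-/

namespace Summit.Ventures.DiscreteObjects.Hadamard

open Finset BigOperators Matrix

open Literature.Combinatorics.Designs.GoethalsSeidel (IsHadamardMatrix)

variable {ι : Type*} [Fintype ι] [DecidableEq ι]

/-! ## §1 Regular Hadamard matrices have square order -/

/-- for `Hᵀ H = n·I` the squared row sums of `H` add up to `n · |ι|`: `Σ_i (Σ_j H_ij)² = n |ι|` (expand and use column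
orthogonality `Σ_i H_ij H_ik = n [j = k]`). -/
theorem sum_rowsum_sq (H : Matrix ι ι ℤ) {n : ℤ} (hT : Hᵀ * H = n • (1 : Matrix ι ι ℤ)) :
    ∑ i, (∑ j, H i j) ^ 2 = n * Fintype.card ι := by
  have hcol : ∀ j k, ∑ i, H i j * H i k = if j = k then n else 0 := by
    intro j k
    have e := congrFun (congrFun hT j) k
    rw [Matrix.mul_apply] at e
    simpa [Matrix.transpose_apply, Matrix.smul_apply, Matrix.one_apply] using e
  calc ∑ i, (∑ j, H i j) ^ 2 = ∑ i, ∑ j, ∑ k, H i j * H i k := by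
        refine Finset.sum_congr rfl (fun i _ => ?_); rw [sq, Finset.sum_mul_sum]
    _ = ∑ j, ∑ k, ∑ i, H i j * H i k := by
        rw [Finset.sum_comm]; exact Finset.sum_congr rfl (fun j _ => Finset.sum_comm)
    _ = ∑ j, ∑ k, (if j = k then n else 0) := by
        exact Finset.sum_congr rfl (fun j _ => Finset.sum_congr rfl (fun k _ => hcol j k))
    _ = n * Fintype.card ι := by simp [Finset.sum_ite_eq, Finset.card_univ, mul_comm]

/-- **A regular Hadamard matrix has square order**: if `H` is Hadamard of order `n` with all row sums equal to `s`, then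
`s² = n`. -/
theorem regular_hadamard_rowsum_sq {H : Matrix ι ι ℤ} (hH : IsHadamardMatrix H) {s : ℤ} (hs : ∀ i, ∑ j, H i j = s)
    [Nonempty ι] : s ^ 2 = Fintype.card ι := by
  have hn : (Fintype.card ι : ℤ) ≠ 0 := by exact_mod_cast Fintype.card_ne_zero
  have hT := transpose_mul_self_of_mul_transpose H _ hn hH.2
  have h := sum_rowsum_sq H hT
  rw [Finset.sum_congr rfl (fun i _ => by rw [hs i]), Finset.sum_const, Finset.card_univ, nsmul_eq_mul] at h
  have : (Fintype.card ι : ℤ) * (s ^ 2 - Fintype.card ι) = 0 := by linarith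
  rcases mul_eq_zero.mp this with h0 | h0
  · exact absurd h0 hn
  · linarith

/-- `668` is not a perfect square. -/
lemma not_isSquare_668 : ¬ ∃ m : ℤ, m ^ 2 = 668 := by
  rintro ⟨m, hm⟩
  have h1' : (m.natAbs : ℤ) ^ 2 = 668 := by rw [Int.natAbs_pow_two]; exact hm
  have h1 : m.natAbs ^ 2 = 668 := by exact_mod_cast h1'
  have : m.natAbs ≤ 25 ∨ 26 ≤ m.natAbs := by omega
  rcases this with h | h
  · have := Nat.pow_le_pow_left h 2; omega
  · have := Nat.pow_le_pow_left h 2; omega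

/-- **No regular Hadamard matrix of order `668`** (all row sums equal): in particular no Bush-type and no Menon-type
(`(4u², 2u² ± u, u² ± u)` difference set) Hadamard matrix of order `668`. -/
theorem no_regular_hadamard668 (hι : Fintype.card ι = 668) {H : Matrix ι ι ℤ} (hH : IsHadamardMatrix H) {s : ℤ}
    (hs : ∀ i, ∑ j, H i j = s) : False := by
  haveI : Nonempty ι := Fintype.card_pos_iff.mp (by rw [hι]; norm_num)
  have h := regular_hadamard_rowsum_sq hH hs
  rw [hι] at h
  exact not_isSquare_668 ⟨s, by exact_mod_cast h⟩

/-! ## §2 Graphical Hadamard matrices (symmetric, constant diagonal) have square order -/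

/-- **A symmetric Hadamard matrix with constant diagonal has square order** (`n = m²` for some integer `m`). -/
theorem graphical_hadamard_isSquare {H : Matrix ι ι ℤ} (hH : IsHadamardMatrix H) (hsym : Hᵀ = H) {δ : ℤ}
    (hdiag : ∀ i, H i i = δ) : ∃ m : ℤ, m ^ 2 = Fintype.card ι := by
  rcases isEmpty_or_nonempty ι with hι | hι
  · exact ⟨0, by simp [Fintype.card_eq_zero]⟩
  set N : ℕ := Fintype.card ι with hN
  -- pass to `ℝ`
  set G : Matrix ι ι ℝ := H.map (Int.castRingHom ℝ) with hGdef
  have hGsym : Gᵀ = G := by rw [hGdef, ← Matrix.transpose_map, hsym]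
  have hG : G.IsHermitian := Matrix.isHermitian_iff_isSymm.mpr hGsym
  have hHH : H * H = (N : ℤ) • (1 : Matrix ι ι ℤ) := by
    have := hH.2; rwa [hsym] at this
  have hGG : G * G = (N : ℝ) • (1 : Matrix ι ι ℝ) := by
    have e : G * G = (H * H).map (Int.castRingHom ℝ) := by rw [hGdef, Matrix.map_mul]
    rw [e, hHH]
    ext i j
    simp only [Matrix.map_apply, Matrix.smul_apply, Matrix.one_apply, smul_eq_mul]
    split_ifs <;> simp
  -- every eigenvalue squares to `N`
  have hev : ∀ i, hG.eigenvalues i ^ 2 = N := by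
    intro i
    have hv := hG.mulVec_eigenvectorBasis i
    have hv2 : (G * G) *ᵥ ⇑(hG.eigenvectorBasis i) = (hG.eigenvalues i ^ 2) • ⇑(hG.eigenvectorBasis i) := by
      rw [← Matrix.mulVec_mulVec, hv, Matrix.mulVec_smul, hv, smul_smul, sq]
    rw [hGG, Matrix.smul_mulVec, Matrix.one_mulVec] at hv2
    have hne : (⇑(hG.eigenvectorBasis i) : ι → ℝ) ≠ 0 := by
      intro h0
      exact hG.eigenvectorBasis.orthonormal.ne_zero i ((WithLp.ofLp_eq_zero (p := 2)).mp h0)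
    obtain ⟨j, hj⟩ := Function.ne_iff.mp hne
    have e := congrFun hv2 j
    simp only [Pi.smul_apply, smul_eq_mul] at e
    have : ((N : ℝ) - hG.eigenvalues i ^ 2) * (⇑(hG.eigenvectorBasis i) : ι → ℝ) j = 0 := by linarith
    rcases mul_eq_zero.mp this with h | h
    · linarith
    · exact absurd h hj
  -- each eigenvalue is `± √N`
  have hsq : Real.sqrt (N : ℝ) ^ 2 = N := Real.sq_sqrt (Nat.cast_nonneg N)
  have hpm : ∀ i, ∃ s : ℤ, (s = 1 ∨ s = -1) ∧ hG.eigenvalues i = s * Real.sqrt N := by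
    intro i
    have h2 : hG.eigenvalues i ^ 2 = Real.sqrt N ^ 2 := by rw [hev i, hsq]
    rcases sq_eq_sq_iff_eq_or_eq_neg.mp h2 with e | e
    · exact ⟨1, Or.inl rfl, by push_cast; linarith⟩
    · exact ⟨-1, Or.inr rfl, by push_cast; linarith⟩
  choose sgn hsgn using hpm
  -- trace: `N δ = (Σ sgn) √N`
  have htr : G.trace = ∑ i, hG.eigenvalues i := by
    have := hG.trace_eq_sum_eigenvalues
    simpa [RCLike.ofReal_real_eq_id] using this
  have htr' : G.trace = (N : ℝ) * δ := by
    rw [Matrix.trace]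
    simp only [Matrix.diag_apply, hGdef, Matrix.map_apply, hdiag, eq_intCast, Finset.sum_const, Finset.card_univ,
      nsmul_eq_mul, hN]
  set m : ℤ := ∑ i, sgn i with hm
  have hsum : ∑ i, hG.eigenvalues i = (m : ℝ) * Real.sqrt N := by
    rw [Finset.sum_congr rfl (fun i _ => (hsgn i).2), ← Finset.sum_mul, hm]; push_cast; rfl
  have key : (N : ℝ) * δ = m * Real.sqrt N := by rw [← htr', htr, hsum]
  have hδ : (δ : ℝ) ^ 2 = 1 := by
    obtain ⟨i⟩ := hι
    rcases hH.1 i i with h | h <;> rw [hdiag] at h <;> rw [h] <;> norm_num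
  have key2 : ((N : ℝ) * δ) ^ 2 = (m * Real.sqrt N) ^ 2 := by rw [key]
  rw [mul_pow, mul_pow, hδ, hsq, mul_one] at key2
  -- `N² = m² N` in `ℤ`, `N > 0`
  have key3 : ((N : ℤ) : ℝ) ^ 2 = ((m ^ 2 * N : ℤ) : ℝ) := by push_cast; linarith
  have key4 : (N : ℤ) ^ 2 = m ^ 2 * N := by exact_mod_cast key3
  have hNpos : (0 : ℤ) < N := by exact_mod_cast Fintype.card_pos
  refine ⟨m, ?_⟩
  have : (N : ℤ) * (N - m ^ 2) = 0 := by linarith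
  rcases mul_eq_zero.mp this with h | h
  · linarith
  · linarith

/-- **No graphical Hadamard matrix of order `668`**: no symmetric `H(668)` with constant diagonal (hence no regular symmetric
Hadamard matrix with constant diagonal, RSHCD, of order `668`). -/
theorem no_graphical_hadamard668 (hι : Fintype.card ι = 668) {H : Matrix ι ι ℤ} (hH : IsHadamardMatrix H)
    (hsym : Hᵀ = H) {δ : ℤ} (hdiag : ∀ i, H i i = δ) : False := by
  obtain ⟨m, hm⟩ := graphical_hadamard_isSquare hH hsym hdiag
  rw [hι] at hm
  exact not_isSquare_668 ⟨m, by exact_mod_cast hm⟩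

/-! ## §3 (appended, gen 27) Symmetric Hadamard matrices of non-square order have zero trace -/

/-- **trace of a symmetric Hadamard matrix**: if `H` is a symmetric Hadamard matrix of order `N` then `(tr H)² = m² N` for
some integer `m` (over `ℝ`, `H` is Hermitian with `H² = N I`, each eigenvalue is `±√N`, `tr H = m √N`). -/
theorem symm_hadamard_trace_sq {H : Matrix ι ι ℤ} (hH : IsHadamardMatrix H) (hsym : Hᵀ = H) :
    ∃ m : ℤ, (∑ i, H i i) ^ 2 = m ^ 2 * Fintype.card ι := by
  rcases isEmpty_or_nonempty ι with hι | hι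
  · exact ⟨0, by simp⟩
  set N : ℕ := Fintype.card ι with hN
  set G : Matrix ι ι ℝ := H.map (Int.castRingHom ℝ) with hGdef
  have hGsym : Gᵀ = G := by rw [hGdef, ← Matrix.transpose_map, hsym]
  have hG : G.IsHermitian := Matrix.isHermitian_iff_isSymm.mpr hGsym
  have hHH : H * H = (N : ℤ) • (1 : Matrix ι ι ℤ) := by
    have := hH.2; rwa [hsym] at this
  have hGG : G * G = (N : ℝ) • (1 : Matrix ι ι ℝ) := by
    have e : G * G = (H * H).map (Int.castRingHom ℝ) := by rw [hGdef, Matrix.map_mul]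
    rw [e, hHH]
    ext i j
    simp only [Matrix.map_apply, Matrix.smul_apply, Matrix.one_apply, smul_eq_mul]
    split_ifs <;> simp
  have hev : ∀ i, hG.eigenvalues i ^ 2 = N := by
    intro i
    have hv := hG.mulVec_eigenvectorBasis i
    have hv2 : (G * G) *ᵥ ⇑(hG.eigenvectorBasis i) = (hG.eigenvalues i ^ 2) • ⇑(hG.eigenvectorBasis i) := by
      rw [← Matrix.mulVec_mulVec, hv, Matrix.mulVec_smul, hv, smul_smul, sq]
    rw [hGG, Matrix.smul_mulVec, Matrix.one_mulVec] at hv2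
    have hne : (⇑(hG.eigenvectorBasis i) : ι → ℝ) ≠ 0 := by
      intro h0
      exact hG.eigenvectorBasis.orthonormal.ne_zero i ((WithLp.ofLp_eq_zero (p := 2)).mp h0)
    obtain ⟨j, hj⟩ := Function.ne_iff.mp hne
    have e := congrFun hv2 j
    simp only [Pi.smul_apply, smul_eq_mul] at e
    have : ((N : ℝ) - hG.eigenvalues i ^ 2) * (⇑(hG.eigenvectorBasis i) : ι → ℝ) j = 0 := by linarith
    rcases mul_eq_zero.mp this with h | h
    · linarith
    · exact absurd h hj
  have hsq : Real.sqrt (N : ℝ) ^ 2 = N := Real.sq_sqrt (Nat.cast_nonneg N)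
  have hpm : ∀ i, ∃ s : ℤ, (s = 1 ∨ s = -1) ∧ hG.eigenvalues i = s * Real.sqrt N := by
    intro i
    have h2 : hG.eigenvalues i ^ 2 = Real.sqrt N ^ 2 := by rw [hev i, hsq]
    rcases sq_eq_sq_iff_eq_or_eq_neg.mp h2 with e | e
    · exact ⟨1, Or.inl rfl, by push_cast; linarith⟩
    · exact ⟨-1, Or.inr rfl, by push_cast; linarith⟩
  choose sgn hsgn using hpm
  have htr : G.trace = ∑ i, hG.eigenvalues i := by
    have := hG.trace_eq_sum_eigenvalues
    simpa [RCLike.ofReal_real_eq_id] using this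
  have htr' : G.trace = ((∑ i, H i i : ℤ) : ℝ) := by
    rw [Matrix.trace]; push_cast
    simp only [Matrix.diag_apply, hGdef, Matrix.map_apply, eq_intCast]
  set m : ℤ := ∑ i, sgn i with hm
  have hsum : ∑ i, hG.eigenvalues i = (m : ℝ) * Real.sqrt N := by
    rw [Finset.sum_congr rfl (fun i _ => (hsgn i).2), ← Finset.sum_mul, hm]; push_cast; rfl
  have key : ((∑ i, H i i : ℤ) : ℝ) = m * Real.sqrt N := by rw [← htr', htr, hsum]
  have key2 : (((∑ i, H i i : ℤ) : ℝ)) ^ 2 = (m * Real.sqrt N) ^ 2 := by rw [key]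
  rw [mul_pow, hsq] at key2
  refine ⟨m, ?_⟩
  exact_mod_cast key2

/-- `T² = m² N` with `T ≠ 0` forces `N` to be a perfect square. -/
lemma isSquare_of_sq_eq_mul_sq {T m : ℤ} {N : ℕ} (h : T ^ 2 = m ^ 2 * N) (hT : T ≠ 0) : ∃ q : ℤ, q ^ 2 = N := by
  have hm : m ≠ 0 := by rintro rfl; apply hT; simpa using h
  have hdvd : m ^ 2 ∣ T ^ 2 := ⟨N, by rw [h]⟩
  obtain ⟨q, hq⟩ := (Int.pow_dvd_pow_iff two_ne_zero).mp hdvd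
  refine ⟨q, ?_⟩
  have : m ^ 2 * q ^ 2 = m ^ 2 * N := by rw [← h, hq]; ring
  exact mul_left_cancel₀ (pow_ne_zero 2 hm) this

/-- **A symmetric Hadamard matrix of non-square order has zero trace** (as many `+1` as `−1` on the diagonal). -/
theorem symm_hadamard_trace_eq_zero {H : Matrix ι ι ℤ} (hH : IsHadamardMatrix H) (hsym : Hᵀ = H)
    (hns : ¬ ∃ q : ℤ, q ^ 2 = Fintype.card ι) : ∑ i, H i i = 0 := by
  obtain ⟨m, hm⟩ := symm_hadamard_trace_sq hH hsym
  by_contra hT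
  exact hns (isSquare_of_sq_eq_mul_sq hm hT)

/-- **Every symmetric Hadamard matrix of order `668` has trace `0`**: exactly `334` diagonal entries equal `+1` and `334` equal
`−1` (in particular none has constant diagonal — `no_graphical_hadamard668` again).  Consistent with the two symmetric
routes in the tree: the propus array and the conference doubling both have trace `0` identically. -/
theorem symmHadamard668_trace_zero (hι : Fintype.card ι = 668) {H : Matrix ι ι ℤ} (hH : IsHadamardMatrix H)
    (hsym : Hᵀ = H) : ∑ i, H i i = 0 :=
  symm_hadamard_trace_eq_zero hH hsym (by rw [hι]; exact_mod_cast not_isSquare_668)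

/-- the diagonal count: a symmetric `H(668)` has exactly `334` diagonal entries `+1`. -/
theorem symmHadamard668_diag_count (hι : Fintype.card ι = 668) {H : Matrix ι ι ℤ} (hH : IsHadamardMatrix H)
    (hsym : Hᵀ = H) : (Finset.univ.filter fun i => H i i = 1).card = 334 := by
  have htr := symmHadamard668_trace_zero hι hH hsym
  have hsplit : ∀ i, H i i = (if H i i = 1 then 2 else 0) - 1 := by
    intro i; rcases hH.1 i i with h | h <;> rw [h] <;> norm_num
  rw [Finset.sum_congr rfl (fun i _ => hsplit i), Finset.sum_sub_distrib, Finset.sum_const, Finset.card_univ, hι,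
    Finset.sum_ite, Finset.sum_const, Finset.sum_const_zero, add_zero] at htr
  simp only [nsmul_eq_mul] at htr
  push_cast at htr
  omega

end Summit.Ventures.DiscreteObjects.Hadamard
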